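import Mathlib

/-!
# Shape packing for ordered escape ladders — decoder certificate for the difference map

Support file for item `stmt-MatrixMultiplication-14308` (`FourierTwoFamiliesModP.PrimeTwoFamilies`,
CKSU 2005 Conj. 4.7 with prime cyclic hosts), line `Sketch`, registered stub
`ladder_sum_card_mul_card_le_of_subshape` (siege k8, variation "certificate / decide on the finite
core"; independent proofs of the same statement live in the namespaces `…PrimeTwoFamilies.LadderLift`,
`…LadderLift.SiegeK21`, `…LadderMergedPair`; this file is self-contained, in its own namespace).

A LADDER in an additive commutative group `G` is an ordered family `(X c, Y c)_{c < r}` of finite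
subsets with

* (`hW`, directness) `(x - x') + (y - y') = 0 → x = x' ∧ y = y'` for `x, x' ∈ X c`, `y, y' ∈ Y c`;
* (`hL`, one-directional separation) for `p < q`, no lower cross difference `y' - x'`
  (`x' ∈ X p`, `y' ∈ Y q`) equals a diagonal difference `y - x` (`x ∈ X c`, `y ∈ Y c`, any `c`).

THE STUB.  If one pattern `Y₀` has a translate `u c +ᵥ Y₀ ⊆ Y c` inside the `Y`-side of every class
`c ∈ S`, then `(Σ_{c ∈ S} |X c|) · |Y₀| ≤ |G|`.

DESIGN (certificate on the finite core).  The packing inequality is certified by the DIFFERENCE MAP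
`Φ : (c, x, y₀) ↦ y₀ - x` on the block set `T := S.sigma (c ↦ X c ×ˢ Y₀)` (of cardinality
`(Σ_{c ∈ S} |X c|) · |Y₀|`) together with an explicit LEFT INVERSE on the class coordinate, computed
by deciding finitely many memberships: for `g : G` put

  `Q(g) := {d ∈ S | g + u d ∈ Y d - X d}`   (a `Finset.filter` of a decidable predicate),

the classes at which `g`, shifted by the class translation, is a diagonal difference.  The finite
core is the pair of facts

1. (`mem_decodeFilter`) the true class qualifies: `g = y₀ - x`, `x ∈ X c` gives
   `g + u c = (u c + y₀) - x ∈ Y c - X c`;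
2. (`le_of_mem_decodeFilter`) every qualifying class lies BELOW the true one: if `c < d` and
   `g + u d = y' - x'` with `x' ∈ X d`, `y' ∈ Y d`, then the diagonal difference `y' - x'` of class
   `d` equals the cross difference `(u d + y₀) - x` from `X c × Y d`, against `hL` at `(d, c, d)`;

so `class = max' Q(Φ(c, x, y₀))` (`max'_decodeFilter_eq`) — the class is a FUNCTION of the value
`Φ(c, x, y₀)`, hence two colliding blocks have the same class, without any case distinction on the
order of the two classes.  Inside one class the pair `(x, y₀)` is decoded by directness
(`eq_of_sub_eq_sub_of_direct`).  `Finset.card_le_card_of_injOn` then gives the bound.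
-/

-- single-conjunct summit: the mandated namespace repeats `MatrixMultiplication` (summit = sub-problem).
set_option linter.dupNamespace false

namespace Summit.MatrixMultiplication.MatrixMultiplication.Theorems.PrimeTwoFamilies.LadderSubshapeDecode

open Finset
open scoped Pointwise

/-- **Finite core (1): the true class qualifies.**  If `c ∈ S`, `x ∈ X c`, `y₀ ∈ Y₀` and
`g = y₀ - x`, then `g + u c = (u c + y₀) - x` is a diagonal difference of class `c` (as
`u c + y₀ ∈ u c +ᵥ Y₀ ⊆ Y c`), i.e. `c` belongs to the decoding filter
`{d ∈ S | g + u d ∈ Y d - X d}`. -/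
theorem mem_decodeFilter {G : Type*} [AddCommGroup G] [DecidableEq G] {r : ℕ}
    (X Y : Fin r → Finset G) (S : Finset (Fin r)) (Y₀ : Finset G) (u : Fin r → G)
    (hY : ∀ c ∈ S, u c +ᵥ Y₀ ⊆ Y c) {c : Fin r} (hc : c ∈ S) {x y₀ g : G} (hx : x ∈ X c)
    (hy₀ : y₀ ∈ Y₀) (hg : g = y₀ - x) :
    c ∈ S.filter fun d => g + u d ∈ Y d - X d := by
  rw [Finset.mem_filter]
  refine ⟨hc, Finset.mem_sub.2 ⟨u c + y₀, hY c hc (Finset.mem_vadd_finset.2 ⟨y₀, hy₀, rfl⟩),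
    x, hx, ?_⟩⟩
  rw [hg]
  abel

/-- **Finite core (2): qualifying classes lie below the true class.**  If `x ∈ X c`, `y₀ ∈ Y₀`,
`g = y₀ - x`, and `d ∈ S` qualifies (`g + u d ∈ Y d - X d`), then `d ≤ c`: otherwise `c < d` and
the diagonal difference `y' - x' = g + u d` of class `d` equals the cross difference
`(u d + y₀) - x` with `x ∈ X c`, `u d + y₀ ∈ Y d`, contradicting the separation `hL` at
`(d, c, d)`. -/
theorem le_of_mem_decodeFilter {G : Type*} [AddCommGroup G] [DecidableEq G] {r : ℕ}
    (X Y : Fin r → Finset G)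
    (hL : ∀ c p q : Fin r, p < q → ∀ x ∈ X c, ∀ y ∈ Y c, ∀ x' ∈ X p, ∀ y' ∈ Y q, y - x ≠ y' - x')
    (S : Finset (Fin r)) (Y₀ : Finset G) (u : Fin r → G) (hY : ∀ c ∈ S, u c +ᵥ Y₀ ⊆ Y c)
    {c : Fin r} {x y₀ g : G} (hx : x ∈ X c) (hy₀ : y₀ ∈ Y₀) (hg : g = y₀ - x) {d : Fin r}
    (hd : d ∈ S.filter fun d => g + u d ∈ Y d - X d) : d ≤ c := by
  rw [Finset.mem_filter, Finset.mem_sub] at hd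
  obtain ⟨hdS, y', hy', x', hx', he⟩ := hd
  refine not_lt.mp fun hlt => hL d c d hlt x' hx' y' hy' x hx (u d + y₀)
    (hY d hdS (Finset.mem_vadd_finset.2 ⟨y₀, hy₀, rfl⟩)) ?_
  rw [he, hg]
  abel

/-- **The certificate: an explicit decoder for the class coordinate.**  For `c ∈ S`, `x ∈ X c`,
`y₀ ∈ Y₀` and `g = y₀ - x`, the class `c` is recovered from the value `g` alone as the largest
qualifying class: `c = max' {d ∈ S | g + u d ∈ Y d - X d}`. -/
theorem max'_decodeFilter_eq {G : Type*} [AddCommGroup G] [DecidableEq G] {r : ℕ}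
    (X Y : Fin r → Finset G)
    (hL : ∀ c p q : Fin r, p < q → ∀ x ∈ X c, ∀ y ∈ Y c, ∀ x' ∈ X p, ∀ y' ∈ Y q, y - x ≠ y' - x')
    (S : Finset (Fin r)) (Y₀ : Finset G) (u : Fin r → G) (hY : ∀ c ∈ S, u c +ᵥ Y₀ ⊆ Y c)
    {c : Fin r} (hc : c ∈ S) {x y₀ g : G} (hx : x ∈ X c) (hy₀ : y₀ ∈ Y₀) (hg : g = y₀ - x)
    (H : (S.filter fun d => g + u d ∈ Y d - X d).Nonempty) :
    (S.filter fun d => g + u d ∈ Y d - X d).max' H = c :=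
  le_antisymm (Finset.max'_le _ H c fun _ hd => le_of_mem_decodeFilter X Y hL S Y₀ u hY hx hy₀ hg hd)
    (Finset.le_max' _ c (mem_decodeFilter X Y S Y₀ u hY hc hx hy₀ hg))

/-- **Decoding inside one class (directness).**  If `c ∈ S` (so `u c +ᵥ Y₀ ⊆ Y c`) and class `c`
is direct, then `y₀ - x = y₀' - x'` with `x, x' ∈ X c`, `y₀, y₀' ∈ Y₀` forces `x = x'` and
`y₀ = y₀'`: the collision reads `(x - x') + ((u c + y₀') - (u c + y₀)) = 0` in `X c × Y c`. -/
theorem eq_of_sub_eq_sub_of_direct {G : Type*} [AddCommGroup G] [DecidableEq G] {r : ℕ}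
    (X Y : Fin r → Finset G)
    (hW : ∀ c : Fin r, ∀ x ∈ X c, ∀ x' ∈ X c, ∀ y ∈ Y c, ∀ y' ∈ Y c,
      (x - x') + (y - y') = 0 → x = x' ∧ y = y')
    (S : Finset (Fin r)) (Y₀ : Finset G) (u : Fin r → G) (hY : ∀ c ∈ S, u c +ᵥ Y₀ ⊆ Y c)
    {c : Fin r} (hc : c ∈ S) {x x' y₀ y₀' : G} (hx : x ∈ X c) (hx' : x' ∈ X c) (hy₀ : y₀ ∈ Y₀)
    (hy₀' : y₀' ∈ Y₀) (h : y₀ - x = y₀' - x') : x = x' ∧ y₀ = y₀' := by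
  have hmem : ∀ b ∈ Y₀, u c + b ∈ Y c := fun b hb =>
    hY c hc (Finset.mem_vadd_finset.2 ⟨b, hb, rfl⟩)
  have e : (x - x') + ((u c + y₀') - (u c + y₀)) = (y₀' - x') - (y₀ - x) := by abel
  obtain ⟨h1, h2⟩ := hW c x hx x' hx' (u c + y₀') (hmem y₀' hy₀') (u c + y₀) (hmem y₀ hy₀)
    (by rw [e, h, sub_self])
  exact ⟨h1, (add_left_cancel h2).symm⟩

/-- **A common translated sub-pattern packs (ladders)** — registered stub
`ladder_sum_card_mul_card_le_of_subshape` of crux `FourierTwoFamiliesModP.PrimeTwoFamilies`, line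
`Sketch`.  If `(X c, Y c)_{c < r}` is a ladder (`hW`: every class direct; `hL`: lower cross differences
avoid all diagonal differences) and a translate `u c +ᵥ Y₀` of one pattern `Y₀` lies inside `Y c` for
every `c ∈ S`, then `(Σ_{c ∈ S} |X c|) · |Y₀| ≤ |G|`.

Proof: the difference map `(c, x, y₀) ↦ y₀ - x` on `S.sigma (c ↦ X c ×ˢ Y₀)` has a left inverse —
the class is `max' {d ∈ S | g + u d ∈ Y d - X d}` of the value `g` (`max'_decodeFilter_eq`), and
inside a class the pair is decoded by directness (`eq_of_sub_eq_sub_of_direct`) — so it is injective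
into `G` (`Finset.card_le_card_of_injOn`). -/
theorem ladder_sum_card_mul_card_le_of_subshape {G : Type*} [AddCommGroup G] [Fintype G]
    [DecidableEq G] {r : ℕ} (X Y : Fin r → Finset G)
    (hW : ∀ c : Fin r, ∀ x ∈ X c, ∀ x' ∈ X c, ∀ y ∈ Y c, ∀ y' ∈ Y c,
      (x - x') + (y - y') = 0 → x = x' ∧ y = y')
    (hL : ∀ c p q : Fin r, p < q → ∀ x ∈ X c, ∀ y ∈ Y c, ∀ x' ∈ X p, ∀ y' ∈ Y q, y - x ≠ y' - x')
    (S : Finset (Fin r)) (Y₀ : Finset G) (u : Fin r → G) (hY : ∀ c ∈ S, u c +ᵥ Y₀ ⊆ Y c) :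
    (∑ c ∈ S, (X c).card) * Y₀.card ≤ Fintype.card G := by
  -- the block set `T := S.sigma (c ↦ X c ×ˢ Y₀)` has the cardinality on the left
  have hT : (S.sigma fun c => X c ×ˢ Y₀).card = (∑ c ∈ S, (X c).card) * Y₀.card := by
    rw [Finset.card_sigma, Finset.sum_mul]
    exact Finset.sum_congr rfl fun c _ => Finset.card_product _ _
  rw [← hT, ← Finset.card_univ]
  -- the certificate: the difference map, injective because it has a decoder
  refine Finset.card_le_card_of_injOn (fun z => z.2.2 - z.2.1) (fun _ _ => Finset.mem_univ _) ?_
  rintro ⟨c, x, y₀⟩ hz ⟨c', x', y₀'⟩ hz' hg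
  simp only [Finset.coe_sigma, Set.mem_sigma_iff, Finset.mem_coe, Finset.mem_product] at hz hz'
  obtain ⟨hc, hx, hy₀⟩ := hz
  obtain ⟨hc', hx', hy₀'⟩ := hz'
  change y₀ - x = y₀' - x' at hg
  -- class coordinate: both classes are the decoder value of the common difference `y₀ - x`
  have H : (S.filter fun d => (y₀ - x) + u d ∈ Y d - X d).Nonempty :=
    ⟨c, mem_decodeFilter X Y S Y₀ u hY hc hx hy₀ rfl⟩
  have hcc : c = c' :=
    (max'_decodeFilter_eq X Y hL S Y₀ u hY hc hx hy₀ rfl H).symm.trans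
      (max'_decodeFilter_eq X Y hL S Y₀ u hY hc' hx' hy₀' hg H)
  subst hcc
  -- pair coordinate: directness of the class
  obtain ⟨rfl, rfl⟩ := eq_of_sub_eq_sub_of_direct X Y hW S Y₀ u hY hc hx hx' hy₀ hy₀' hg
  rfl

end Summit.MatrixMultiplication.MatrixMultiplication.Theorems.PrimeTwoFamilies.LadderSubshapeDecode
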